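import Literature.MathematicalPhysics.QuantumFieldTheory.Balaban1983to89.B9Cor36GCubeWindows
import Literature.MathematicalPhysics.QuantumFieldTheory.Balaban1983to89.B9Eq337CutFieldDirY
import Literature.MathematicalPhysics.QuantumFieldTheory.Balaban1983to89.B7Prop2Explicit

/-!
# `Balaban1983to89.B9Cor36GDirCutWindows` — [Balaban1985BackgroundPropagators] Cor. 3.6 p. 408 with (3.37) p. 396 FOR THE SHARP-CUT SMALL FIELD
# `Ṽ = cutCfgS i T η A = e^{iηA·𝟙[bond ⊂ T]}·1` OF A COVER CUBE: THE BOND, VARIATION AND PLAQUETTE WINDOWS `hW1 ∕ hW2 ∕ hW3` OF THE FIRST-ORDER (3.84) PIECES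
# (✓`hasMajorant_V0Y ∕ V1Y ∕ P0Y ∕ P1Y`) AT EVERY CUBE BLOCK's SCALE in the block-distance-2 neighbourhood, the bi-contractivity `hU`, and the end-block smallness of
# `Ã` for the knit averaging piece — from ✓`readings337_cutFldS` (jumps only on level-0 rows) and the level slack ✓`len_le_L_mul_len_of_dist_le_two` (cost: one
# factor `L²`) — seat dag-n06-c g34, FILE F3 of road (B5)'s rest (the windows binder of the `G`-step at the letter of record)

statement-level skeleton of published theorems with citation tags; proofs where landed; nothing here is a claim about the Yang–Mills mass gap

CITATION HEADER (lean-in-tree rule).  B9 = T. Bałaban, *Propagators for lattice gauge theories in a background field*, Commun. Math. Phys. **99** (1985)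
389–434 [Balaban1985BackgroundPropagators] (held `paper:balaban1985-cmp99-background-propagators`; journal page = PDF page + 388): Cor. 3.6 p. 408 l. 1–14 («Applying
the gauge transformation u we get U′ = Uᵘ = e^{iηA} … U′ satisfies (3.37) for the sequence {Ω′_j} with U = 1 and α₁ = O(1)Mα₀»); (3.37) p. 396 («|A′| < α₁(Lʲη)⁻¹,
|∇^η A′| < α₁(Lʲη)⁻² on Ω_j»); (3.69)–(3.73) pp. 404–405 (the first-order pieces and their bound «the norms determined by the set st(b)»); p. 408 (the collars of the
sequence `{Ω_n(□)}`: positive levels sit inside `Ω₀(□)`); Thm 3.4 p. 400.  [4] = [Balaban1984PropagatorsII] (2.2) p. 224 (neighbouring blocks differ by one level;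
runs of `≥ RM` blocks per level), (2.51) p. 232.  Rows B9.Cor3.6 × B9.Eq3.37 × B9.Eq3.73 (cells only; no row head changes).

WHY THIS FILE (cell `pub-ymgap`, node N06 [B9]; dag-n06-d g35's LOCATED-35: the letter of record must be evaluated at a field cut at `T ⊋ Ω₀(□)`).  The `G`-step at
the Dirichlet bond letter of record (F4) needs the (3.73)∕(3.75) piece majorants of ✓`B9Ineq373HessianPieceBoundsY` ∕ ✓`B9Ineq375GradDivBoundsY`, whose hypotheses are
WINDOWS of the small field in the block-distance-2 neighbourhood of every cube block `a`: `‖Ṽ − 1‖ ≤ α(η∕len a)`, `‖Ṽ(y) − Ṽ(y − e_μ)‖ ≤ α(η∕len a)²`, `‖Re Ṽ(∂p) − 1‖,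
‖Im Ṽ(∂p)‖ ≤ α(η∕len a)²`, and bi-contractivity.  r05's bridge II (✓`B9Cor36GCubeWindows`) proved them for its SMOOTH cut-off `e^{iηχ̃_□A}` globally; the letter of record
uses the SHARP cut `cutCfgS i T η A` (✓`B9Eq337CutFieldDirY`), whose (3.37) readings hold AT EACH SITE's OWN BLOCK SCALE (✓`readings337_cutFldS`: the indicator jumps only on
level-`0` rows, where the allowed size is `α₁η⁻²`) once `T` contains the 2-step stencil of every positive-level site.  THIS FILE converts own-scale readings into the
neighbourhood windows: blocks at block-graph distance `≤ 2` differ by at most ONE level (✓`scale_sub_le_one_of_dist_le_two`, `RM1 > 2`), so `len a ≤ L·len(blk y)` and a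
reading at `y`'s own scale is a window at `a`'s scale up to `L²` — NO collar hypothesis beyond the stencil.  Plus the bi-contractivity of `Ṽ` (from the Hermitian type of `A`,
or — over `M_N(ℂ)` — from the unitarity of the datum `Uᵘ = e^{iηA}` on `T`) and the end-block smallness of `Ã = A·𝟙[bond ⊂ T]` for dag-n06-j's ✓`hasMajorant_avgPieceCKnit`.

WHAT IS PROVED (0 `def`s; theorems; 0 sorry; 0 new named facts; standard axioms):
* §1 `cutCfgS_eq_prodCfg` (`Ṽ = e^{iηÃ}·1`, r06's product configuration), `readings_cut` (the five (3.37) readings of `Ã` at the cube lengths), `len_le_L_mul_len_of_dSite`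
  (level slack, symmetric form), `norm_cutFldS_le_blk`, `eta_mul_norm_cutFldS_le` (`η‖Ã‖ ≤ α₁`);
* §2 ★★`hW1_cut`, ★★`hW2_cut`, ★★`hW3_cut` (the three window binders at `V := cutCfgS i T η A`, constant `α_T := alphaW α₁ · L²`, `α₁ = 2CΛ²`);
* §3 `unitaryLike_cutCfgS` (bi-contractivity from the Hermitian type), ★`unitaryLike_cutCfgS_of_unitary` (over `M_N(ℂ)`: from the unitarity of `u`, `U` and the datum
  `Uᵘ = e^{iηA}` on `Q ⊇ chart⁻¹T`), ★`ha_cut` (`Lᴶη‖Ã_μ(x)‖ ≤ α₁` at every index bond level `J ≤ n + 1` — the `ha` binder of ✓`hasMajorant_avgPieceCKnit`, `a := Ã`).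

HONEST SCOPE / NOT CLAIMED.  Dictionary + inequalities over landed modules (✓`readings337_cutFldS`, ✓`B9Cor36GCubeWindowsPointwise`); no operator estimate here (the piece
majorants are instantiated in F4).  DISPLAYED (hypotheses): the (3.35) datum `(A; Q, C, ξ, Λ)` on `Q ⊇ chart⁻¹T`, the 2-step stencil of the positive-level sites inside `T`
(for `T ⊇ Ω₀(□)`: ✓`collarS2Y`), the member threshold `2 < RM1`.  Nothing on `d = 4`, the continuum, reflection positivity or the mass gap; NOT a node discharge; count-neutral;
no row head changes.  NEW file; nothing landed is modified.  `--supports stmt-QuantumFields-27239`.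

RELATED IN THE TREE, NOT DUPLICATED (searched 2026-08-31: `rg 'hW1_cut|hW2_cut|hW3_cut|readings_cut|ha_cut|unitaryLike_cutCfgS'` over `Literature/` + `Summits/` = ∅):
✓`B9Cor36GCubeWindows` (r05's smooth cut-off: `hW1_locCfgY` … — the pattern), ✓`B9Cor36GCubeWindowsPointwise` (the pointwise windows + level slack, USED),
✓`B9Eq337CutFieldDirY` (the sharp cut and its readings, USED), this seat's ✓`B9Cor36GpDirExtAtField` (the SITE letter at the sharp cut — different pieces, no windows).
-/

noncomputable section

namespace Literature.MathematicalPhysics.QuantumFieldTheory.Balaban1983to89.B9Cor36GDirCutWindows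

open NormedSpace Complex
open B6KLevelCensusIndexV1 (KIdx kGeo)
open B6GlobalChartV1 (PV boxEquiv)
open B6Cover236MultiLevelBlocks (cubes)
open B5Eq118OneStroke (iterBlockOf)
open B9Eq39Adjoint (prodCfg fluct covD covDstar)
open B9BackgroundsKLevelV1 (shiftsV1)
open B9Eq337CutFieldDirY (cutFldS cutCfgS cutAc chartA_cutFldS cutAc_apply_of UboxY_cutCfgS readings337_cutFldS)
open B9Eq360DeltaPrimeAY (AfldY chartA chartA_apply)
open B9Eq369Product (val_fluct val_inv_fluct)
open B9CubeLettersOpsL0 (cubeFamY levCubeY)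
open B9CubeLettersBondOpsL0 (BlkCubeY IBondCubeY)
open B9Eq360DeltaPrimeACubeY (blkCubeY)
open B9CubeGeometryInputs (geoCK geoCK_len geoCK_len_pos geoCK_eta geoCK_eta_pos geoCK_eta_le_len geoCK_len_blkCubeY geoCK_dist_axioms RM1)
open B9Cor36CubeCutoffs (scaleLen_levCubeY_bounds)
open B9Cor36GCubeWindows (alphaW alphaW_nonneg mul_exp_le_alphaW exp_mul_le_alphaW unitaryLike_holY scaleLen_ibond_bounds)
open B9Cor36GCubeWindowsPointwise (norm_prodCfg_one_sub_one_le norm_prodCfg_one_sub_le norm_holY_prodCfg_sub_one_le norm_reHolY_imHolY_le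
  len_le_L_mul_len_of_dist_le_two)
open B9Ineq373HessianPieceBoundsY (dSite)
open B7Prop2Explicit (unitaryUnits unitaryUnits_le_U1)
open Node00 (SiteY CfgY GaugeY PlaqY toKT shiftY gaugeY UboxY holY reHolY imHolY)
open Node00.OpsYNablaBridge (chartY shiftY_chartY shiftY_symm_chartY shift_unshift)
open scoped Matrix Matrix.Norms.L2Operator

variable {d ℓ : ℕ} {hd : 1 ≤ d + 1} {hL : Odd (ℓ + 1) ∧ 1 < ℓ + 1} {b₀ b₁ : ℝ}
variable {𝔸 : Type} [NormedRing 𝔸] [NormedAlgebra ℂ 𝔸] [CompleteSpace 𝔸]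

/-! ## §1  Dictionary: the sharp cut is r06's product configuration; the (3.37) readings at the cube lengths; level slack -/

section Dictionary

variable (i : KIdx d ℓ hd hL b₀ b₁) (c : ↥(cubes (toKT i).D.toDomains))

/-- `Ṽ = e^{iηÃ}·1` with `Ã = A·𝟙[bond ⊂ T]` IS r06's product configuration over the trivial background (`rfl`). [cite: Balaban1985BackgroundPropagators, p.396 before (3.37), Cor. 3.6 p.408] -/
theorem cutCfgS_eq_prodCfg (T : Finset (SiteY i)) (η : ℝ) (A : AfldY 𝔸 i) :
    cutCfgS i T η A = prodCfg (fun (_ : Fin (d + 1)) (_ : Site (PV d ℓ i.m i.K hd hL) 0) => (1 : 𝔸ˣ)) η (cutFldS i T A) := rfl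

/-- ★ **LEVEL SLACK, SYMMETRIC FORM**: for a cube block `a` and a torus site `y` at block distance `≤ 2`, `len a ≤ L·len(blk y)` (blocks at distance `≤ 2` differ by at most one
level once `RM1 > 2`). [cite: Balaban1984PropagatorsII, (2.2) p.224; Balaban1985BackgroundPropagators, p.408 («This sequence satisfies the conditions (2.1), (2.2)»)] -/
theorem len_le_L_mul_len_of_dSite (hM : 2 < RM1 i) {a : BlkCubeY i c} {y : Site (PV d ℓ i.m i.K hd hL) 0} (h : dSite i c a y ≤ 2) :
    (geoCK i c).len a ≤ ((ℓ : ℝ) + 1) * (geoCK i c).len (blkCubeY i c (chartY i y)) := by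
  obtain ⟨-, -, -, hsym⟩ := geoCK_dist_axioms i c 0 True
  refine len_le_L_mul_len_of_dist_le_two i c hM ?_
  rw [hsym]; exact h

variable {T : Finset (SiteY i)} {A : AfldY 𝔸 i} {Q : Set (Site (PV d ℓ i.m i.K hd hL) 0)} {C ξ Λ : ℝ}
  (hC : 0 ≤ C) (hξ : (kGeo i).eta ≤ ξ) (hΛ : 1 ≤ Λ) (hΛξ : LatticeNorms.scaleLen ((ℓ : ℝ) + 1) (kGeo i).eta (c.1.1 + 1) ≤ Λ * ξ)
  (hQ : ∀ z ∈ T, (boxEquiv i.hN).symm z ∈ Q)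
  (hA : ∀ κ, ∀ x ∈ Q, ‖A κ x‖ ≤ C * ξ⁻¹)
  (hdA : ∀ μ ν, ∀ x ∈ Q, ‖(((kGeo i).eta : ℂ)⁻¹) • covD (shiftsV1 (PV d ℓ i.m i.K hd hL)) (fun _ _ => (1 : 𝔸ˣ)) μ (A ν) x‖ ≤ C * (ξ ^ 2)⁻¹)
  (hS2 : ∀ z : SiteY i, 1 ≤ levCubeY i c z → z ∈ T ∧ ∀ μ, shiftY i μ z ∈ T ∧ (shiftY i μ).symm z ∈ T ∧
    ∀ ν, shiftY i ν (shiftY i μ z) ∈ T ∧ shiftY i ν ((shiftY i μ).symm z) ∈ T ∧ (shiftY i ν).symm ((shiftY i μ).symm z) ∈ T)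

omit [CompleteSpace 𝔸] in
include hC hξ hΛ hΛξ hQ hA hdA hS2 in
/-- ★ **THE (3.37) READINGS OF `Ã = A·𝟙[bond ⊂ T]` AT THE CUBE LENGTHS** `len z = L^{lev_□ z}η` (✓`readings337_cutFldS` with the stencil premise keyed on the positive cube
level): backward ∕ forward differences and the `τ`-shifted difference `≤ α₁(len z²)⁻¹·η`, values and `τ`-shifted values `≤ α₁(len z)⁻¹`, `α₁ = 2CΛ²`.
[cite: Balaban1985BackgroundPropagators, (3.37) p.396, Cor. 3.6 p.408, p.408 (collars)] -/
theorem readings_cut :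
    (∀ ν κ z, ‖(((kGeo i).eta : ℂ)⁻¹) • covDstar (shiftY i) (fun _ _ => (1 : 𝔸ˣ)) ν (chartA i (cutFldS i T A) κ) z‖ ≤
      2 * C * Λ ^ 2 * ((geoCK i c).len (blkCubeY i c z) ^ 2)⁻¹) ∧
    (∀ μ ν z, ‖(((kGeo i).eta : ℂ)⁻¹) • covD (shiftY i) (fun _ _ => (1 : 𝔸ˣ)) μ (chartA i (cutFldS i T A) ν) z‖ ≤
      2 * C * Λ ^ 2 * ((geoCK i c).len (blkCubeY i c z) ^ 2)⁻¹) ∧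
    (∀ κ z, ‖chartA i (cutFldS i T A) κ z‖ ≤ 2 * C * Λ ^ 2 * ((geoCK i c).len (blkCubeY i c z))⁻¹) := by
  have hη : 0 < (kGeo i).eta := by rw [← geoCK_eta i c]; exact geoCK_eta_pos i c
  have hL1 : (1 : ℝ) ≤ (ℓ : ℝ) + 1 := by linarith [(Nat.cast_nonneg ℓ : (0 : ℝ) ≤ ℓ)]
  have hlenS : ∀ z : SiteY i, (geoCK i c).len (blkCubeY i c z) = LatticeNorms.scaleLen ((ℓ : ℝ) + 1) (kGeo i).eta (levCubeY i c z) := fun z => by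
    rw [(geoCK_len_blkCubeY i c z).1]; rfl
  have hlenη : ∀ z : SiteY i, (kGeo i).eta ≤ (geoCK i c).len (blkCubeY i c z) := fun z => by
    rw [← geoCK_eta i c]; exact geoCK_eta_le_len i c _
  have hlenΛ : ∀ z : SiteY i, (geoCK i c).len (blkCubeY i c z) ≤ Λ * ξ := fun z => by
    rw [hlenS]; exact (scaleLen_levCubeY_bounds i c hL1 hη hΛξ z).2
  have hS2' : ∀ z : SiteY i, (kGeo i).eta < (geoCK i c).len (blkCubeY i c z) → z ∈ T ∧ ∀ μ, shiftY i μ z ∈ T ∧ (shiftY i μ).symm z ∈ T ∧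
      ∀ ν, shiftY i ν (shiftY i μ z) ∈ T ∧ shiftY i ν ((shiftY i μ).symm z) ∈ T ∧ (shiftY i ν).symm ((shiftY i μ).symm z) ∈ T := fun z hz =>
    hS2 z (by
      by_contra h0
      have h0' : levCubeY i c z = 0 := by omega
      rw [(geoCK_len_blkCubeY i c z).1, h0', pow_zero, one_mul] at hz
      exact lt_irrefl _ hz)
  obtain ⟨r1, r2, -, r4, -⟩ := readings337_cutFldS i hC hη hξ hΛ hQ hA hdA (fun z => (geoCK i c).len (blkCubeY i c z)) hlenη hlenΛ hS2'
  exact ⟨r1, r2, r4⟩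

omit [CompleteSpace 𝔸] in
include hC hξ hΛ hΛξ hQ hA hdA hS2 in
/-- the value of `Ã` at a torus site, at its own block scale: `‖Ã_κ(y)‖ ≤ α₁·len(blk y)⁻¹`. [cite: Balaban1985BackgroundPropagators, (3.37) p.396] -/
theorem norm_cutFldS_le_blk (κ : Fin (d + 1)) (y : Site (PV d ℓ i.m i.K hd hL) 0) :
    ‖cutFldS i T A κ y‖ ≤ 2 * C * Λ ^ 2 * ((geoCK i c).len (blkCubeY i c (chartY i y)))⁻¹ := by
  have h := (readings_cut i c hC hξ hΛ hΛξ hQ hA hdA hS2).2.2 κ (chartY i y)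
  rwa [chartA_apply, show (boxEquiv i.hN).symm (chartY i y) = y from Equiv.symm_apply_apply _ _] at h

omit [CompleteSpace 𝔸] in
include hC hξ hΛ hΛξ hQ hA hdA hS2 in
/-- `η‖Ã_κ(y)‖ ≤ α₁` everywhere (`η ≤ len`). [cite: Balaban1985BackgroundPropagators, (3.37) p.396, bookkeeping] -/
theorem eta_mul_norm_cutFldS_le (κ : Fin (d + 1)) (y : Site (PV d ℓ i.m i.K hd hL) 0) : (kGeo i).eta * ‖cutFldS i T A κ y‖ ≤ 2 * C * Λ ^ 2 := by
  have hη : 0 < (kGeo i).eta := by rw [← geoCK_eta i c]; exact geoCK_eta_pos i c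
  have hα : 0 ≤ 2 * C * Λ ^ 2 := by positivity
  have hl : (kGeo i).eta ≤ (geoCK i c).len (blkCubeY i c (chartY i y)) := by rw [← geoCK_eta i c]; exact geoCK_eta_le_len i c _
  have hlen := geoCK_len_pos i c (blkCubeY i c (chartY i y))
  calc (kGeo i).eta * ‖cutFldS i T A κ y‖ ≤ (kGeo i).eta * (2 * C * Λ ^ 2 * ((geoCK i c).len (blkCubeY i c (chartY i y)))⁻¹) :=
        mul_le_mul_of_nonneg_left (norm_cutFldS_le_blk i c hC hξ hΛ hΛξ hQ hA hdA hS2 κ y) hη.le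
    _ = 2 * C * Λ ^ 2 * ((kGeo i).eta / (geoCK i c).len (blkCubeY i c (chartY i y))) := by ring
    _ ≤ 2 * C * Λ ^ 2 * 1 := mul_le_mul_of_nonneg_left ((div_le_one hlen).2 hl) hα
    _ = 2 * C * Λ ^ 2 := mul_one _

end Dictionary

/-! ## §2  ★★ The window binders `hW1 ∕ hW2 ∕ hW3` at `V := cutCfgS i T η A`, constant `α_T = alphaW(α₁)·L²` -/

section Windows

variable (i : KIdx d ℓ hd hL b₀ b₁) (c : ↥(cubes (toKT i).D.toDomains))
variable {T : Finset (SiteY i)} {A : AfldY 𝔸 i} {Q : Set (Site (PV d ℓ i.m i.K hd hL) 0)} {C ξ Λ : ℝ}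
  (hC : 0 ≤ C) (hξ : (kGeo i).eta ≤ ξ) (hΛ : 1 ≤ Λ) (hΛξ : LatticeNorms.scaleLen ((ℓ : ℝ) + 1) (kGeo i).eta (c.1.1 + 1) ≤ Λ * ξ)
  (hQ : ∀ z ∈ T, (boxEquiv i.hN).symm z ∈ Q)
  (hA : ∀ κ, ∀ x ∈ Q, ‖A κ x‖ ≤ C * ξ⁻¹)
  (hdA : ∀ μ ν, ∀ x ∈ Q, ‖(((kGeo i).eta : ℂ)⁻¹) • covD (shiftsV1 (PV d ℓ i.m i.K hd hL)) (fun _ _ => (1 : 𝔸ˣ)) μ (A ν) x‖ ≤ C * (ξ ^ 2)⁻¹)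
  (hS2 : ∀ z : SiteY i, 1 ≤ levCubeY i c z → z ∈ T ∧ ∀ μ, shiftY i μ z ∈ T ∧ (shiftY i μ).symm z ∈ T ∧
    ∀ ν, shiftY i ν (shiftY i μ z) ∈ T ∧ shiftY i ν ((shiftY i μ).symm z) ∈ T ∧ (shiftY i ν).symm ((shiftY i μ).symm z) ∈ T)
  (hM : 2 < RM1 i)
include hC hξ hΛ hΛξ hQ hA hdA hS2 hM

section NormOne

variable [NormOneClass 𝔸]

/-- ★★ **`hW1` AT THE SHARP CUT**: `‖Ṽ_{a′}(y) − 1‖ ≤ α_T·η∕len(a)` for every cube block `a`, direction `a′` and torus site `y` at block distance `≤ 2` from `a`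
(own-scale value reading × `e^{α₁}`, one factor `L` of level slack; `α_T = alphaW(α₁)·L²`). [cite: Balaban1985BackgroundPropagators, Cor. 3.6 p.408, (3.37) p.396, (3.73) p.405] -/
theorem hW1_cut :
    ∀ (a : BlkCubeY i c) (a' : Fin (d + 1)) (y : Site (PV d ℓ i.m i.K hd hL) 0), dSite i c a y ≤ 2 →
      ‖(cutCfgS i T (kGeo i).eta A a' y : 𝔸) - 1‖ ≤ alphaW (2 * C * Λ ^ 2) * ((ℓ : ℝ) + 1) ^ 2 * ((kGeo i).eta * ((geoCK i c).len a)⁻¹) := by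
  intro a a' y hd2
  have hη : 0 < (kGeo i).eta := by rw [← geoCK_eta i c]; exact geoCK_eta_pos i c
  have hα : 0 ≤ 2 * C * Λ ^ 2 := by positivity
  have hL1 : (1 : ℝ) ≤ (ℓ : ℝ) + 1 := by linarith [(Nat.cast_nonneg ℓ : (0 : ℝ) ≤ ℓ)]
  have hla := geoCK_len_pos i c a
  have hlb := geoCK_len_pos i c (blkCubeY i c (chartY i y))
  set lb := (geoCK i c).len (blkCubeY i c (chartY i y)) with hlbdef
  rw [cutCfgS_eq_prodCfg]
  refine (norm_prodCfg_one_sub_one_le i hη.le (cutFldS i T A) a' y).trans ?_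
  have h1 : (kGeo i).eta * ‖cutFldS i T A a' y‖ ≤ 2 * C * Λ ^ 2 * ((kGeo i).eta * lb⁻¹) := by
    have := mul_le_mul_of_nonneg_left (norm_cutFldS_le_blk i c hC hξ hΛ hΛξ hQ hA hdA hS2 a' y) hη.le
    rw [← hlbdef] at this; linarith [this, show (kGeo i).eta * (2 * C * Λ ^ 2 * lb⁻¹) = 2 * C * Λ ^ 2 * ((kGeo i).eta * lb⁻¹) by ring]
  have h2 : Real.exp ((kGeo i).eta * ‖cutFldS i T A a' y‖) ≤ Real.exp (2 * C * Λ ^ 2) :=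
    Real.exp_le_exp.2 (eta_mul_norm_cutFldS_le i c hC hξ hΛ hΛξ hQ hA hdA hS2 a' y)
  -- level slack: `lb⁻¹ ≤ L·(len a)⁻¹`
  have hslack : lb⁻¹ ≤ ((ℓ : ℝ) + 1) * ((geoCK i c).len a)⁻¹ := by
    have h := len_le_L_mul_len_of_dSite i c hM hd2
    rw [← hlbdef] at h
    rw [inv_le_comm₀ hlb (by positivity), mul_inv, inv_inv]
    calc (((ℓ : ℝ) + 1))⁻¹ * (geoCK i c).len a ≤ (((ℓ : ℝ) + 1))⁻¹ * (((ℓ : ℝ) + 1) * lb) := mul_le_mul_of_nonneg_left h (by positivity)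
      _ = lb := by field_simp
  have hL2 : ((ℓ : ℝ) + 1) ≤ ((ℓ : ℝ) + 1) ^ 2 := by nlinarith
  calc (kGeo i).eta * ‖cutFldS i T A a' y‖ * Real.exp ((kGeo i).eta * ‖cutFldS i T A a' y‖)
      ≤ 2 * C * Λ ^ 2 * ((kGeo i).eta * lb⁻¹) * Real.exp (2 * C * Λ ^ 2) := mul_le_mul h1 h2 (Real.exp_pos _).le (by positivity)
    _ = (2 * C * Λ ^ 2 * Real.exp (2 * C * Λ ^ 2)) * ((kGeo i).eta * lb⁻¹) := by ring
    _ ≤ alphaW (2 * C * Λ ^ 2) * ((kGeo i).eta * (((ℓ : ℝ) + 1) * ((geoCK i c).len a)⁻¹)) :=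
        mul_le_mul (mul_exp_le_alphaW hα) (mul_le_mul_of_nonneg_left hslack hη.le) (by positivity) (alphaW_nonneg hα)
    _ = alphaW (2 * C * Λ ^ 2) * ((ℓ : ℝ) + 1) * ((kGeo i).eta * ((geoCK i c).len a)⁻¹) := by ring
    _ ≤ alphaW (2 * C * Λ ^ 2) * ((ℓ : ℝ) + 1) ^ 2 * ((kGeo i).eta * ((geoCK i c).len a)⁻¹) := by
        have : 0 ≤ alphaW (2 * C * Λ ^ 2) * ((kGeo i).eta * ((geoCK i c).len a)⁻¹) := by have := alphaW_nonneg hα; positivity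
        nlinarith

/-- ★★ **`hW2` AT THE SHARP CUT**: `‖Ṽ_{a′}(y) − Ṽ_{a′}(y − e_μ)‖ ≤ α_T·(η∕len a)²` (own-scale backward-difference reading × `e^{α₁}`, two factors `L`).
[cite: Balaban1985BackgroundPropagators, Cor. 3.6 p.408, (3.37) p.396 (the `|∇^ηA′|` half), (3.73) p.405] -/
theorem hW2_cut :
    ∀ (a : BlkCubeY i c) (a' μ : Fin (d + 1)) (y : Site (PV d ℓ i.m i.K hd hL) 0), dSite i c a y ≤ 2 →
      ‖(cutCfgS i T (kGeo i).eta A a' y : 𝔸) - cutCfgS i T (kGeo i).eta A a' (y.unshift μ)‖ ≤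
        alphaW (2 * C * Λ ^ 2) * ((ℓ : ℝ) + 1) ^ 2 * ((kGeo i).eta * ((geoCK i c).len a)⁻¹) ^ 2 := by
  intro a a' μ y hd2
  have hη : 0 < (kGeo i).eta := by rw [← geoCK_eta i c]; exact geoCK_eta_pos i c
  have hα : 0 ≤ 2 * C * Λ ^ 2 := by positivity
  have hla := geoCK_len_pos i c a
  have hlb := geoCK_len_pos i c (blkCubeY i c (chartY i y))
  set lb := (geoCK i c).len (blkCubeY i c (chartY i y)) with hlbdef
  rw [cutCfgS_eq_prodCfg]
  refine (norm_prodCfg_one_sub_le i hη.le (cutFldS i T A) a' y (y.unshift μ) (eta_mul_norm_cutFldS_le i c hC hξ hΛ hΛξ hQ hA hdA hS2 a' y)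
    (eta_mul_norm_cutFldS_le i c hC hξ hΛ hΛξ hQ hA hdA hS2 a' (y.unshift μ))).trans ?_
  -- the backward difference at `y`'s own scale
  have hdiff : ‖cutFldS i T A a' y - cutFldS i T A a' (y.unshift μ)‖ ≤ (kGeo i).eta * (2 * C * Λ ^ 2 * (lb ^ 2)⁻¹) := by
    have h := (readings_cut i c hC hξ hΛ hΛξ hQ hA hdA hS2).1 μ a' (chartY i y)
    rw [covDstar, inv_one, B9Eq39Adjoint.R_one, shiftY_symm_chartY, chartA_apply, chartA_apply,
      show (boxEquiv i.hN).symm (chartY i y) = y from Equiv.symm_apply_apply _ _,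
      show (boxEquiv i.hN).symm (chartY i (y.unshift μ)) = y.unshift μ from Equiv.symm_apply_apply _ _, norm_smul, norm_inv, Complex.norm_real,
      Real.norm_of_nonneg hη.le, ← norm_neg, neg_sub] at h
    have h' := mul_le_mul_of_nonneg_left h hη.le
    rwa [← mul_assoc, mul_inv_cancel₀ hη.ne', one_mul, ← hlbdef] at h'
  have hslack : lb⁻¹ ≤ ((ℓ : ℝ) + 1) * ((geoCK i c).len a)⁻¹ := by
    have h := len_le_L_mul_len_of_dSite i c hM hd2
    rw [← hlbdef] at h
    rw [inv_le_comm₀ hlb (by positivity), mul_inv, inv_inv]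
    calc (((ℓ : ℝ) + 1))⁻¹ * (geoCK i c).len a ≤ (((ℓ : ℝ) + 1))⁻¹ * (((ℓ : ℝ) + 1) * lb) := mul_le_mul_of_nonneg_left h (by positivity)
      _ = lb := by field_simp
  have hslack2 : (lb ^ 2)⁻¹ ≤ ((ℓ : ℝ) + 1) ^ 2 * ((geoCK i c).len a)⁻¹ ^ 2 := by
    rw [← inv_pow, ← mul_pow]; exact pow_le_pow_left₀ (inv_nonneg.2 hlb.le) hslack 2
  calc (kGeo i).eta * ‖cutFldS i T A a' y - cutFldS i T A a' (y.unshift μ)‖ * Real.exp (2 * C * Λ ^ 2)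
      ≤ (kGeo i).eta * ((kGeo i).eta * (2 * C * Λ ^ 2 * (lb ^ 2)⁻¹)) * Real.exp (2 * C * Λ ^ 2) :=
        mul_le_mul_of_nonneg_right (mul_le_mul_of_nonneg_left hdiff hη.le) (Real.exp_pos _).le
    _ = (2 * C * Λ ^ 2 * Real.exp (2 * C * Λ ^ 2)) * ((kGeo i).eta ^ 2 * (lb ^ 2)⁻¹) := by ring
    _ ≤ alphaW (2 * C * Λ ^ 2) * ((kGeo i).eta ^ 2 * (((ℓ : ℝ) + 1) ^ 2 * ((geoCK i c).len a)⁻¹ ^ 2)) :=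
        mul_le_mul (mul_exp_le_alphaW hα) (mul_le_mul_of_nonneg_left hslack2 (sq_nonneg _)) (by positivity) (alphaW_nonneg hα)
    _ = alphaW (2 * C * Λ ^ 2) * ((ℓ : ℝ) + 1) ^ 2 * ((kGeo i).eta * ((geoCK i c).len a)⁻¹) ^ 2 := by ring

end NormOne

/-- ★★ **`hW3` AT THE SHARP CUT** (bi-contractive `Ṽ`): `‖Re Ṽ(∂p) − 1‖, ‖Im Ṽ(∂p)‖ ≤ α_T·(η∕len a)²` for every cube block `a` and plaquette `p` whose source is at block
distance `≤ 2` from `a` (r06's second-order plaquette bound at `p.src`'s own scale, two factors `L`). [cite: Balaban1985BackgroundPropagators, (3.69) p.404, (3.37) p.396, Cor. 3.6 p.408] -/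
theorem hW3_cut (hU : ∀ μ x, ‖(cutCfgS i T (kGeo i).eta A μ x : 𝔸)‖ ≤ 1 ∧ ‖(((cutCfgS i T (kGeo i).eta A μ x)⁻¹ : 𝔸ˣ) : 𝔸)‖ ≤ 1) :
    ∀ (a : BlkCubeY i c) (p : PlaqY i), dSite i c a p.src ≤ 2 →
      ‖reHolY i (cutCfgS i T (kGeo i).eta A) p - 1‖ ≤ alphaW (2 * C * Λ ^ 2) * ((ℓ : ℝ) + 1) ^ 2 * ((kGeo i).eta * ((geoCK i c).len a)⁻¹) ^ 2 ∧
        ‖imHolY i (cutCfgS i T (kGeo i).eta A) p‖ ≤ alphaW (2 * C * Λ ^ 2) * ((ℓ : ℝ) + 1) ^ 2 * ((kGeo i).eta * ((geoCK i c).len a)⁻¹) ^ 2 := by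
  intro a p hd2
  have hη : 0 < (kGeo i).eta := by rw [← geoCK_eta i c]; exact geoCK_eta_pos i c
  have hα : 0 ≤ 2 * C * Λ ^ 2 := by positivity
  have hla := geoCK_len_pos i c a
  obtain ⟨x, μ, ν, hμν⟩ := p
  have hlb := geoCK_len_pos i c (blkCubeY i c (chartY i x))
  set lb := (geoCK i c).len (blkCubeY i c (chartY i x)) with hlbdef
  have hηl : (kGeo i).eta ≤ lb := by rw [hlbdef, ← geoCK_eta i c]; exact geoCK_eta_le_len i c _
  obtain ⟨-, r2, -⟩ := readings_cut i c hC hξ hΛ hΛξ hQ hA hdA hS2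
  -- the four readings at `x`'s own scale
  have hval : ∀ κ, ‖cutFldS i T A κ x‖ ≤ 2 * C * Λ ^ 2 * lb⁻¹ := fun κ => norm_cutFldS_le_blk i c hC hξ hΛ hΛξ hQ hA hdA hS2 κ x
  have hdif : ∀ κ κ', ‖cutFldS i T A κ' (x.shift κ) - cutFldS i T A κ' x‖ ≤ (kGeo i).eta * (2 * C * Λ ^ 2 * (lb ^ 2)⁻¹) := fun κ κ' => by
    have h := r2 κ κ' (chartY i x)
    rw [covD, B9Eq39Adjoint.R_one, shiftY_chartY, chartA_apply, chartA_apply,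
      show (boxEquiv i.hN).symm (chartY i x) = x from Equiv.symm_apply_apply _ _,
      show (boxEquiv i.hN).symm (chartY i (x.shift κ)) = x.shift κ from Equiv.symm_apply_apply _ _, norm_smul, norm_inv, Complex.norm_real,
      Real.norm_of_nonneg hη.le] at h
    have h' := mul_le_mul_of_nonneg_left h hη.le
    rwa [← mul_assoc, mul_inv_cancel₀ hη.ne', one_mul, ← hlbdef] at h'
  have hhol : ‖(holY i (cutCfgS i T (kGeo i).eta A) ⟨x, μ, ν, hμν⟩ : 𝔸) - 1‖ ≤ alphaW (2 * C * Λ ^ 2) * ((kGeo i).eta * lb⁻¹) ^ 2 := by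
    rw [cutCfgS_eq_prodCfg]
    refine (norm_holY_prodCfg_sub_one_le i hη hηl (cutFldS i T A) x hμν (hval μ) (hval ν) (hdif μ ν) (hdif ν μ)).trans ?_
    rw [div_eq_mul_inv]
    have ht : (kGeo i).eta * lb⁻¹ ≤ 1 := by rw [← div_eq_mul_inv, div_le_one hlb]; exact hηl
    exact mul_le_mul_of_nonneg_right (exp_mul_le_alphaW hα ht) (sq_nonneg _)
  have hslack : lb⁻¹ ≤ ((ℓ : ℝ) + 1) * ((geoCK i c).len a)⁻¹ := by
    have h := len_le_L_mul_len_of_dSite i c hM hd2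
    rw [← hlbdef] at h
    rw [inv_le_comm₀ hlb (by positivity), mul_inv, inv_inv]
    calc (((ℓ : ℝ) + 1))⁻¹ * (geoCK i c).len a ≤ (((ℓ : ℝ) + 1))⁻¹ * (((ℓ : ℝ) + 1) * lb) := mul_le_mul_of_nonneg_left h (by positivity)
      _ = lb := by field_simp
  have hsq : ((kGeo i).eta * lb⁻¹) ^ 2 ≤ ((ℓ : ℝ) + 1) ^ 2 * ((kGeo i).eta * ((geoCK i c).len a)⁻¹) ^ 2 := by
    rw [← mul_pow]
    refine pow_le_pow_left₀ (by positivity) ?_ 2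
    calc (kGeo i).eta * lb⁻¹ ≤ (kGeo i).eta * (((ℓ : ℝ) + 1) * ((geoCK i c).len a)⁻¹) := mul_le_mul_of_nonneg_left hslack hη.le
      _ = ((ℓ : ℝ) + 1) * ((kGeo i).eta * ((geoCK i c).len a)⁻¹) := by ring
  have hw : ‖(holY i (cutCfgS i T (kGeo i).eta A) ⟨x, μ, ν, hμν⟩ : 𝔸) - 1‖ ≤
      alphaW (2 * C * Λ ^ 2) * ((ℓ : ℝ) + 1) ^ 2 * ((kGeo i).eta * ((geoCK i c).len a)⁻¹) ^ 2 :=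
    hhol.trans (by rw [mul_assoc (alphaW _) (((ℓ : ℝ) + 1) ^ 2)]; exact mul_le_mul_of_nonneg_left hsq (alphaW_nonneg hα))
  have hh := (T4RelativeLadder.unitaryLike_iff _).1 (unitaryLike_holY i hU ⟨x, μ, ν, hμν⟩)
  have hri := norm_reHolY_imHolY_le i (cutCfgS i T (kGeo i).eta A) ⟨x, μ, ν, hμν⟩ hh.2
  exact ⟨hri.1.trans hw, hri.2.trans hw⟩

end Windows

/-! ## §3  Bi-contractivity of the cut field; the end-block smallness of `Ã` for the knit averaging piece -/

section Contractive

variable (i : KIdx d ℓ hd hL b₀ b₁) (c : ↥(cubes (toKT i).D.toDomains))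

/-- **BI-CONTRACTIVITY OF `Ṽ` FROM THE HERMITIAN TYPE of the datum's field** (`‖e^{itA}‖ ≤ 1` for every real `t`): `‖Ṽ_κ(x)‖ ≤ 1`, `‖Ṽ_κ(x)⁻¹‖ ≤ 1` (twin of r05's
✓`unitaryLike_locCfgY`). [cite: Balaban1985BackgroundPropagators, (3.35) p.396, Cor. 3.6 p.408] -/
theorem unitaryLike_cutCfgS [NormOneClass 𝔸] {T : Finset (SiteY i)} {A : AfldY 𝔸 i}
    (hAu : ∀ (t : ℝ) (κ : Fin (d + 1)) (x : Site (PV d ℓ i.m i.K hd hL) 0), ‖NormedSpace.exp ((I * (t : ℂ)) • A κ x)‖ ≤ 1)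
    (η : ℝ) (κ : Fin (d + 1)) (x : Site (PV d ℓ i.m i.K hd hL) 0) :
    ‖(cutCfgS i T η A κ x : 𝔸)‖ ≤ 1 ∧ ‖(((cutCfgS i T η A κ x)⁻¹ : 𝔸ˣ) : 𝔸)‖ ≤ 1 := by
  have h1 : ‖(1 : 𝔸)‖ ≤ 1 := norm_one.le
  have hval : (cutCfgS i T η A κ x : 𝔸ˣ) = fluct η (cutFldS i T A) κ x := by
    show fluct η (cutFldS i T A) κ x * 1 = _; rw [mul_one]
  rw [hval]
  by_cases hb : boxEquiv i.hN x ∈ T ∧ shiftY i κ (boxEquiv i.hN x) ∈ T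
  · have hc : cutFldS i T A κ x = A κ x := by unfold cutFldS; rw [if_pos hb]
    constructor
    · rw [val_fluct, hc]; exact hAu η κ x
    · rw [val_inv_fluct, hc, ← neg_smul]
      have e2 : -(I * (η : ℂ)) = I * ((-η : ℝ) : ℂ) := by push_cast; ring
      rw [e2]; exact hAu _ κ x
  · have hc : cutFldS i T A κ x = 0 := by unfold cutFldS; rw [if_neg hb]
    constructor
    · rw [val_fluct, hc, smul_zero, NormedSpace.exp_zero]; exact h1
    · rw [val_inv_fluct, hc, smul_zero, neg_zero, NormedSpace.exp_zero]; exact h1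

variable {N : ℕ} [Nonempty (Fin N)]

/-- ★ **BI-CONTRACTIVITY OF `Ṽ` OVER `M_N(ℂ)` FROM UNITARITY**: on a bond inside `T` the cut field IS the datum `Uᵘ = e^{iηA}` (a product of unitaries), elsewhere it is `1`.
[cite: Balaban1985BackgroundPropagators, (3.35) p.396 (G-valued), p.408 («U′ = Uᵘ = e^{iηA}»), Cor. 3.6 p.408] -/
theorem unitaryLike_cutCfgS_of_unitary {T : Finset (SiteY i)} {η : ℝ} {A : AfldY (Matrix (Fin N) (Fin N) ℂ) i}
    {u : GaugeY (Matrix (Fin N) (Fin N) ℂ) i} {U : CfgY (Matrix (Fin N) (Fin N) ℂ) i} {Q : Set (Site (PV d ℓ i.m i.K hd hL) 0)}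
    (hu : ∀ z, u z ∈ unitaryUnits (Matrix (Fin N) (Fin N) ℂ)) (hUu : ∀ μ x, U μ x ∈ unitaryUnits (Matrix (Fin N) (Fin N) ℂ))
    (hQ : ∀ z ∈ T, (boxEquiv i.hN).symm z ∈ Q)
    (hgA : ∀ (κ : Fin (d + 1)) (x : Site (PV d ℓ i.m i.K hd hL) 0), x ∈ Q → x.shift κ ∈ Q → gaugeY i u U κ x = fluct η A κ x)
    (κ : Fin (d + 1)) (x : Site (PV d ℓ i.m i.K hd hL) 0) :
    ‖(cutCfgS i T η A κ x : Matrix (Fin N) (Fin N) ℂ)‖ ≤ 1 ∧ ‖(((cutCfgS i T η A κ x)⁻¹ : (Matrix (Fin N) (Fin N) ℂ)ˣ) : Matrix (Fin N) (Fin N) ℂ)‖ ≤ 1 := by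
  letI : CStarAlgebra (Matrix (Fin N) (Fin N) ℂ) := {}
  have hx : boxEquiv i.hN ((boxEquiv i.hN).symm (boxEquiv i.hN x)) = boxEquiv i.hN x := by rw [Equiv.symm_apply_apply]
  have hval : cutCfgS i T η A κ x = UboxY i (cutCfgS i T η A) κ (boxEquiv i.hN x) := by
    show _ = cutCfgS i T η A κ ((boxEquiv i.hN).symm (boxEquiv i.hN x)); rw [Equiv.symm_apply_apply]
  rw [hval, UboxY_cutCfgS]
  split_ifs with hb
  · rw [Equiv.symm_apply_apply]
    have hsh : ((boxEquiv i.hN).symm (boxEquiv i.hN x)).shift κ = (boxEquiv i.hN).symm (shiftY i κ (boxEquiv i.hN x)) := by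
      rw [Equiv.symm_apply_apply, Equiv.eq_symm_apply]; exact (shiftY_chartY i κ x).symm
    have hg : gaugeY i u U κ x = fluct η A κ x := by
      have h := hgA κ ((boxEquiv i.hN).symm (boxEquiv i.hN x)) (hQ _ hb.1) (by rw [hsh]; exact hQ _ hb.2)
      rwa [Equiv.symm_apply_apply] at h
    rw [← hg]
    have hm : gaugeY i u U κ x ∈ unitaryUnits (Matrix (Fin N) (Fin N) ℂ) := by
      rw [Node00.gaugeY_apply]
      exact (unitaryUnits _).mul_mem ((unitaryUnits _).mul_mem (hu _) (hUu _ _)) ((unitaryUnits _).inv_mem (hu _))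
    exact unitaryUnits_le_U1 hm
  · exact ⟨by rw [Units.val_one, norm_one], by rw [inv_one, Units.val_one, norm_one]⟩

variable {T : Finset (SiteY i)} {A : AfldY 𝔸 i} {Q : Set (Site (PV d ℓ i.m i.K hd hL) 0)} {C ξ Λ : ℝ}

omit [NormedAlgebra ℂ 𝔸] [CompleteSpace 𝔸] in
/-- ★ **THE END-BLOCK SMALLNESS OF `Ã` FOR THE KNIT AVERAGING PIECE** (the `ha` binder of ✓`hasMajorant_avgPieceCKnit` with `a := Ã`): `Lᴶη·‖Ã_μ(x)‖ ≤ α₁` for every index bond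
of the cube sequence (level `J ≤ n + 1`, so `Lᴶη ≤ Λξ`) and EVERY torus site `x` (`‖Ã‖ ≤ ‖A‖ ≤ Cξ⁻¹` on `Q ⊇ chart⁻¹T`, `0` off the bonds inside `T`; `ΛC ≤ 2CΛ² = α₁`).
[cite: Balaban1985BackgroundPropagators, (3.37) p.396, (3.83) p.407, Cor. 3.6 p.408] -/
theorem ha_cut (hC : 0 ≤ C) (hΛ : 1 ≤ Λ) (hΛξ : LatticeNorms.scaleLen ((ℓ : ℝ) + 1) (kGeo i).eta (c.1.1 + 1) ≤ Λ * ξ)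
    (hQ : ∀ z ∈ T, (boxEquiv i.hN).symm z ∈ Q) (hA : ∀ κ, ∀ x ∈ Q, ‖A κ x‖ ≤ C * ξ⁻¹) :
    ∀ (ι : IBondCubeY i c) (μ : Fin (d + 1)) (x : Site (PV d ℓ i.m i.K hd hL) 0),
      iterBlockOf (ι.1.1 : ℕ) x = ι.1.2.src ∨ iterBlockOf (ι.1.1 : ℕ) x = ι.1.2.tgt →
        (((ℓ + 1 : ℕ) : ℝ)) ^ (ι.1.1 : ℕ) * (kGeo i).eta * ‖cutFldS i T A μ x‖ ≤ 2 * C * Λ ^ 2 := by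
  intro ι μ x _
  have hη : 0 < (kGeo i).eta := by rw [← geoCK_eta i c]; exact geoCK_eta_pos i c
  obtain ⟨h1, h2⟩ := scaleLen_ibond_bounds i c hΛξ ι
  have hξ0 : 0 < ξ := by
    have : 0 < Λ * ξ := lt_of_lt_of_le (lt_of_lt_of_le hη h1) h2
    by_contra hneg; push Not at hneg
    exact absurd this (not_lt.2 (mul_nonpos_iff.2 (Or.inl ⟨zero_le_one.trans hΛ, hneg⟩)))
  have hLJ : 0 ≤ (((ℓ + 1 : ℕ) : ℝ)) ^ (ι.1.1 : ℕ) * (kGeo i).eta := by positivity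
  by_cases hb : boxEquiv i.hN x ∈ T ∧ shiftY i μ (boxEquiv i.hN x) ∈ T
  · have hc : cutFldS i T A μ x = A μ x := by unfold cutFldS; rw [if_pos hb]
    have hxQ : x ∈ Q := by have := hQ _ hb.1; rwa [Equiv.symm_apply_apply] at this
    rw [hc]
    calc (((ℓ + 1 : ℕ) : ℝ)) ^ (ι.1.1 : ℕ) * (kGeo i).eta * ‖A μ x‖ ≤ (Λ * ξ) * (C * ξ⁻¹) := mul_le_mul h2 (hA μ x hxQ) (norm_nonneg _) (by positivity)
      _ = Λ * C := by field_simp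
      _ ≤ 2 * C * Λ ^ 2 := by nlinarith [mul_nonneg hC (zero_le_one.trans hΛ)]
  · have hc : cutFldS i T A μ x = 0 := by unfold cutFldS; rw [if_neg hb]
    rw [hc, norm_zero, mul_zero]; positivity

end Contractive

end Literature.MathematicalPhysics.QuantumFieldTheory.Balaban1983to89.B9Cor36GDirCutWindows

end
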